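import Summits.HodgeConjecture.HodgeConjecture.Theses.MomentAmplification
import Literature.AlgebraicGeometry.HodgeTheory.MotivatedClasses
import Literature.AlgebraicGeometry.HodgeTheory.MotivatedClassesProofs
import Literature.AlgebraicGeometry.Motives.ComplexPointsManifold
import Literature.AlgebraicGeometry.Motives.VarietiesUnitProofs
import Literature.AlgebraicGeometry.Motives.SegreEmbedding
import Literature.AlgebraicTopology.SingularHomology.CohomologyFiniteness

/-!
# Line `real_carrier_seam` — crux `AlgebraicDensity` of route `MomentAmplification`

Crux item `stmt-HodgeConjecture-11035`, decl
`Summit.HodgeConjecture.HodgeConjecture.Theses.MomentAmplification.AlgebraicDensity`: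
for every comparison-compatible Betti–Hodge datum `B` and every smooth projective `X/ℂ` of
dimension `n`, the `B`-ALGEBRAIC classes of codimension `nN` on `X^{2N}` have density `> 1/2` among
the `B`-Hodge classes there, frequently in `N`.

## The line (strategist, alternative to `Lines/birth.lean`; the live skeleton is untouched)

André's seam `A ⊆ A_mot ⊆ Hdg` is cut at the middle term exactly as in `birth`, but on the
SUMMIT-LAYER ("real") carriers `Hᵏ(X(ℂ); ℂ) = HodgeTheory.complexBetti`, where the tree's André
theory actually lives (`HodgeTheory.motivatedClasses`, `…MotivatedClassesProofs/Algebraic/Deformation*`,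
`MotivatedGaloisGroup`) and where the sibling route `MotivatedLefschetzSplit` keeps its cruxes — instead
of inside the abstract Weil cohomology `B.W` of the datum (`B.W.motivatedClasses`, definitional API only).
The `B`-counts of the crux are moved to the real carriers by the guard `B.IsComparisonCompatible`
((a) Hodge classes ↔ rational `(p,p)` classes, (b) `ℂ · A_B = Nᵖ H²ᵖ`) and rational descent of linear
independence through the comparison (`linearIndependent_toComplexBetti_iff`), all PROVED below:
`dim_ℚ Hdg_B = dim_ℂ ℂ·{rational (p,p) classes}` and `dim_ℚ A_B = dim_ℂ Nᵖ H²ᵖ`.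

* `stub_motivatedDensityHT` — **the bet, `B`-free AND guard-free** (a closed statement about complex
  varieties): for `X` smooth projective of dimension `n` there is `δ > 0` with, frequently in `N`,
  `(1/2 + δ) · dim_ℂ ℂ·{rational classes of type (Nn,Nn) in H^{2Nn}(X^{2N}(ℂ); ℂ)} ≤ dim_ℂ A_mot^{Nn}(X^{2N})_ℂ`.
  Implied by "Hodge ⇒ motivated" in the middle degree of the even self-powers
  (`motivatedDensityHT_of_hodgeMotivatedOnPowers`, proved below, `δ = 1/2`), i.e. by the sibling crux
  `MotivatedLefschetzSplit.HodgeClassesMotivated` on powers; a THEOREM for abelian-type `X`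
  (André 1996 Thm 0.6.2; tree named fact `Andre1996_hodgeClasses_abelianVariety_motivated`), and on this
  layer André's deformation theorem `Andre1996_deformation` (Thm 0.5, unconditional) applies to it.
* `stub_motivatedLeAlgebraicHT` — **`A_mot ⊆ A` on the real carriers** (`motivatedClasses n X p ≤
  algebraicClasses X p` for all smooth projective `X`, all `p`): verbatim the conclusion of the named fact
  `Andre1996_motivatedClasses_le_algebraicClasses_of_standardConjectureB` and of the sibling support
  `MotivatedLefschetzSplit.MotivatedSubAlgebraic`; DISCHARGED from the sibling items
  `LefschetzStandardB` (stmt-HodgeConjecture-17489) and `DiagonalPullbackAlgebraic` (stmt-17490) by the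
  PROVED tree theorem `motivatedClasses_le_algebraicClasses_of_standardConjectureB_of_map_diagonal`
  (`motivatedLeAlgebraicHT_of_standardConjectureB_of_diagonal` below). Standard-conjecture-`B` strength.

`AlgebraicDensity_of` is the real (sorry-free) composition. Neither stub alone gives the crux or the
summit (BC3 probes in the strategist folder `bc/`, all failing).
-/

noncomputable section

namespace Summit.HodgeConjecture.HodgeConjecture.Cruxes.AlgebraicDensity.RealCarrierSeam

open CategoryTheory MonoidalCategory
open Literature.AlgebraicGeometry Literature.AlgebraicGeometry.Motives
open Literature.AlgebraicGeometry.HodgeTheory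
open Summit.HodgeConjecture.HodgeConjecture.Theses.MomentAmplification

/-! ## The two statements -/

/-- **Stub 1 statement — motivated density on the real carriers (the bet).** For every smooth
projective complex `X` of dimension `n` there is `δ > 0` such that, for infinitely many `N` (with a
smooth-projectivity witness of `X^{2N} := Nat.rec 𝟙 (· ⊗ X) (2N)`, dimension `2Nn`),
`(1/2 + δ) · dim_ℂ (ℂ-span of the rational classes of Hodge type (Nn, Nn) in H^{2Nn}(X^{2N}(ℂ); ℂ))
 ≤ dim_ℂ A_mot^{Nn}(X^{2N})_ℂ` (`HodgeTheory.motivatedClasses`, André 1996 Déf. 1 on the real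
carriers). No Betti–Hodge datum, no guard. [cite: Andre1996Motifs, Thm 0.4, Thm 0.6.2 and §4] -/
def MotivatedDensityHT : Prop :=
  ∀ ⦃n : ℕ⦄ ⦃X : Literature.AlgebraicGeometry.Motives.SchemeOver ℂ⦄,
    Literature.AlgebraicGeometry.Motives.IsSmoothProjective n X →
      (let pow := (fun k : ℕ => @Nat.rec (fun _ => Literature.AlgebraicGeometry.Motives.SchemeOver ℂ)
        (CategoryTheory.MonoidalCategoryStruct.tensorUnit (Literature.AlgebraicGeometry.Motives.SchemeOver ℂ))
        (fun _ Y => CategoryTheory.MonoidalCategoryStruct.tensorObj Y X) k);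
      (∃ δ : ℝ, 0 < δ ∧ ∃ᶠ N in Filter.atTop,
        ∃ _hN : Literature.AlgebraicGeometry.Motives.IsSmoothProjective (2 * N * n) (pow (2 * N)),
          (1 / 2 + δ) *
              ((Module.finrank ℂ ↥(Submodule.span ℂ
                {c : Literature.AlgebraicGeometry.HodgeTheory.complexBetti (pow (2 * N)) (2 * (N * n)) |
                  Literature.AlgebraicGeometry.HodgeTheory.IsRationalClass c ∧
                    Literature.AlgebraicGeometry.HodgeTheory.IsOfHodgeType (2 * N * n) (pow (2 * N))
                      (2 * (N * n)) (N * n) (N * n) c})) : ℝ) ≤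
            ((Module.finrank ℂ ↥(Literature.AlgebraicGeometry.HodgeTheory.motivatedClasses
                (2 * N * n) (pow (2 * N)) (N * n))) : ℝ)))

/-- **Stub 2 statement — motivated classes are algebraic, on the real carriers** (`A_motᵖ(X)_ℂ ⊆
Nᵖ H²ᵖ(X(ℂ); ℂ)` for every smooth projective complex `X` and every `p`). Verbatim the conclusion of
the named fact `Andre1996_motivatedClasses_le_algebraicClasses_of_standardConjectureB` (André 1996 §2.1,
remark after Déf. 1: "`A_mot(X) = A(X)` si … l'involution de Lefschetz est donnée par une
correspondance algébrique") and of the sibling support `MotivatedLefschetzSplit.MotivatedSubAlgebraic`;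
of standard-conjecture-`B` strength. [cite: Andre1996Motifs, §2.1 remark following Déf. 1 (p. 14) and §0.3] -/
def MotivatedLeAlgebraicHT : Prop :=
  ∀ ⦃n : ℕ⦄ ⦃X : Literature.AlgebraicGeometry.Motives.SchemeOver ℂ⦄,
    Literature.AlgebraicGeometry.Motives.IsSmoothProjective n X → ∀ p : ℕ,
      Literature.AlgebraicGeometry.HodgeTheory.motivatedClasses n X p ≤
        Literature.AlgebraicGeometry.HodgeTheory.algebraicClasses X p

/-- Stub 1 (the bet): motivated density `> 1/2` on the real carriers, frequently in `N`.
[cite: Andre1996Motifs, Thm 0.4 and Thm 0.6.2] -/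
theorem stub_motivatedDensityHT : MotivatedDensityHT := by
  sorry

/-- Stub 2: `A_mot ⊆ A` on the real carriers (André 1996 §2.1 remark; `B`-strength).
[cite: Andre1996Motifs, §2.1 remark following Déf. 1 (p. 14)] -/
theorem stub_motivatedLeAlgebraicHT : MotivatedLeAlgebraicHT := by
  sorry

/-! ## Name-keyed aliases of the two statements (hypotheses of `AlgebraicDensity_of`; device of
`Lines/birth.lean`: the skeleton audit admits a hypothesis whose head constant is named like a
registered stub). -/
namespace __Registered

/-- Alias of `MotivatedDensityHT` keyed by the registered stub name. -/
abbrev stub_motivatedDensityHT : Prop := MotivatedDensityHT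
/-- Alias of `MotivatedLeAlgebraicHT` keyed by the registered stub name. -/
abbrev stub_motivatedLeAlgebraicHT : Prop := MotivatedLeAlgebraicHT

end __Registered

/-! ## Proved glue: the `B`-counts of the crux on the real carriers -/

section Descent

variable {B : BettiHodgeData ℂ}

/-- **Rational descent of dimension through the comparison.** For a `ℚ`-subspace `V ⊆ Hⁱ_B(Y)` of a
finite-dimensional `Hⁱ_B(Y)`, the `ℂ`-span of its image under the complexified comparison
`Hⁱ_B(Y) → Hⁱ(Y(ℂ); ℂ)` has `ℂ`-dimension `dim_ℚ V` (a `ℚ`-basis of `V` stays `ℂ`-linearly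
independent, `BettiHodgeData.linearIndependent_toComplexBetti_iff`, Voisin I §7.1.1).
[cite: VoisinHodgeI2002, §7.1.1] -/
theorem finrank_span_toComplexBetti_image {Y : SchemeOver ℂ} {i : ℕ} [Module.Finite ℚ (B.W.obj Y i)]
    (V : Submodule ℚ (B.W.obj Y i)) :
    Module.finrank ℂ ↥(Submodule.span ℂ (B.toComplexBetti Y i '' (V : Set (B.W.obj Y i)))) =
      Module.finrank ℚ ↥V := by
  let b := Module.finBasis ℚ ↥V
  have hV : Submodule.span ℚ (Set.range (⇑V.subtype ∘ ⇑b)) = V := by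
    rw [Set.range_comp, Submodule.span_image, b.span_eq, Submodule.map_top, Submodule.range_subtype]
  have hset : (V : Set (B.W.obj Y i)) =
      (Submodule.span ℚ (Set.range (⇑V.subtype ∘ ⇑b)) : Set (B.W.obj Y i)) := by
    rw [hV]
  have hli : LinearIndependent ℂ (⇑(B.toComplexBetti Y i) ∘ (⇑V.subtype ∘ ⇑b)) :=
    (B.linearIndependent_toComplexBetti_iff _).2 (b.linearIndependent.map' V.subtype V.ker_subtype)
  rw [hset, BettiHodgeData.span_toComplexBetti_image_span, ← Set.range_comp,
    finrank_span_eq_card hli]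
  simp

/-- **(a) as an equality of sets**: for a compatible `B`, the rational classes of Hodge type
`(p, p)` in `H²ᵖ(Y(ℂ); ℂ)` are exactly the complexified comparisons of the `B`-Hodge classes.
[cite: Deligne2000, §1] -/
theorem setOf_isRationalClass_and_isOfHodgeType_eq_image (hc : B.IsComparisonCompatible) {d : ℕ}
    {Y : SchemeOver ℂ} (hY : IsSmoothProjective d Y) (p : ℕ) :
    {c : complexBetti Y (2 * p) | IsRationalClass c ∧ IsOfHodgeType d Y (2 * p) p p c} =
      B.toComplexBetti Y (2 * p) ''
        ((B.hodge hY (2 * p)).hodgeClasses (p : ℤ) : Set (B.W.obj Y (2 * p))) := by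
  ext c
  constructor
  · rintro ⟨hr, ht⟩
    obtain ⟨t, rfl⟩ := B.exists_toComplexBetti_eq hr
    exact ⟨t, (hc.mem_hodgeClasses_iff hY p t).2 ht, rfl⟩
  · rintro ⟨t, ht, rfl⟩
    exact ⟨B.isRationalClass_toComplexBetti t, (hc.mem_hodgeClasses_iff hY p t).1 ht⟩

/-- **`h` on the real carriers**: for a compatible `B`,
`dim_ℚ Hdg^p_B(Y) = dim_ℂ ℂ·{rational (p,p) classes in H²ᵖ(Y(ℂ); ℂ)}`. [cite: Deligne2000, §1]
[cite: VoisinHodgeI2002, §7.1.1] -/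
theorem finrank_hodgeClasses_eq (hc : B.IsComparisonCompatible) {d : ℕ} {Y : SchemeOver ℂ}
    (hY : IsSmoothProjective d Y) (p : ℕ) :
    Module.finrank ℚ ↥((B.hodge hY (2 * p)).hodgeClasses (p : ℤ)) =
      Module.finrank ℂ ↥(Submodule.span ℂ
        {c : complexBetti Y (2 * p) | IsRationalClass c ∧ IsOfHodgeType d Y (2 * p) p p c}) := by
  haveI := B.W.finite_obj hY (2 * p)
  rw [setOf_isRationalClass_and_isOfHodgeType_eq_image hc hY p, finrank_span_toComplexBetti_image]

/-- **`m` on the real carriers**: for a compatible `B`, `dim_ℚ A^p_B(Y) = dim_ℂ Nᵖ H²ᵖ(Y(ℂ); ℂ)`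
((b) of the guard and rational descent). [cite: Fulton1998, §19.1 Lemma 19.1.1]
[cite: VoisinHodgeI2002, §7.1.1] -/
theorem finrank_algebraicClasses_eq (hc : B.IsComparisonCompatible) {d : ℕ} {Y : SchemeOver ℂ}
    (hY : IsSmoothProjective d Y) (p : ℕ) :
    Module.finrank ℚ ↥(B.W.algebraicClasses Y p) =
      Module.finrank ℂ ↥(HodgeTheory.algebraicClasses Y p) := by
  haveI := B.W.finite_obj hY (2 * p)
  rw [← finrank_span_toComplexBetti_image (B := B) (B.W.algebraicClasses Y p),
    hc.span_eq_algebraicClasses hY p]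

end Descent

/-- `Hᵏ(Y(ℂ); ℂ)` is finite-dimensional for `Y` smooth projective (`Y(ℂ)` is a compact Hausdorff
topological manifold; the tree's `finite_singularCohomology_of_compact_chartedSpace` — same proof as
`HodgeTheory.finite_complexBetti`, restated to keep this line's imports small).
[cite: HatcherAT2002, App. A Cor. A.8–A.9 and §3.1 Cor. 3.3] -/
theorem finite_complexBetti' {d : ℕ} {Y : SchemeOver ℂ} (hY : IsSmoothProjective d Y) (k : ℕ) :
    Module.Finite ℂ (complexBetti Y k) := by
  letI := hY.chartedSpace
  haveI := ComplexPoints.compactSpace_of_isSmoothProjective hY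
  haveI := ComplexPoints.t2Space_of_isSmoothProjective hY
  exact Literature.AlgebraicTopology.SingularHomology.finite_singularCohomology_of_compact_chartedSpace
    ℂ ℂ (d := 2 * d) k

/-! ## The skeleton theorem -/

/-- **Composition (real proof) — THE SKELETON THEOREM.** Motivated density on the real carriers and
`A_mot ⊆ A` there give the crux: for compatible `B`, on each good `N`,
`(1/2+δ)·h_N^B = (1/2+δ)·dim_ℂ ℂ·{rational (Nn,Nn) classes} ≤ dim_ℂ A_mot ≤ dim_ℂ Nᵖ H²ᵖ = m_N^B`
(`finrank_hodgeClasses_eq`, `finrank_algebraicClasses_eq`, `Submodule.finrank_mono` in the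
finite-dimensional `H^{2Nn}(X^{2N}(ℂ); ℂ)`). Hypotheses = the two stub statements (name-keyed aliases);
concludes the route decl `AlgebraicDensity` BY NAME. -/
theorem AlgebraicDensity_of :
    __Registered.stub_motivatedDensityHT → __Registered.stub_motivatedLeAlgebraicHT →
      AlgebraicDensity := by
  intro h1 h2 B hc n X hX
  obtain ⟨δ, hδ, hfreq⟩ := h1 hX
  refine ⟨δ, hδ, hfreq.mono fun N => ?_⟩
  rintro ⟨hN, hle⟩
  refine ⟨hN, ?_⟩
  rw [finrank_hodgeClasses_eq hc hN (N * n), finrank_algebraicClasses_eq hc hN (N * n)]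
  refine hle.trans ?_
  haveI := finite_complexBetti' hN (2 * (N * n))
  exact_mod_cast Submodule.finrank_mono (h2 hN (N * n))

/-- **The crux, closed modulo exactly the two registered stubs** (sanity: the stubs compose). -/
theorem AlgebraicDensity_of_stubs : AlgebraicDensity :=
  AlgebraicDensity_of stub_motivatedDensityHT stub_motivatedLeAlgebraicHT

/-! ## Feeders (proved): where each stub comes from -/

/-- **Stub 2 from the sibling route's items.** `B` for every smooth projective complex `Z` in
André's form (`MotivatedLefschetzSplit.LefschetzStandardB`, verbatim) and Voisin II Prop. 9.21 (i) for
diagonals (`MotivatedLefschetzSplit.DiagonalPullbackAlgebraic`, verbatim) give `A_mot ⊆ A` on the real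
carriers — a direct call to the tree's PROVED
`motivatedClasses_le_algebraicClasses_of_standardConjectureB_of_map_diagonal`.
[cite: Andre1996Motifs, §2.1 remark following Déf. 1 (p. 14)] [cite: VoisinHodgeII2003, Prop. 9.21] -/
theorem motivatedLeAlgebraicHT_of_standardConjectureB_of_diagonal
    (hB : ∀ (d : ℕ) (Z : SchemeOver ℂ) (η : complexBetti Z 2), IsSmoothProjective d Z →
      StandardConjectureBStar d Z η)
    (hΔ : ∀ ⦃d : ℕ⦄ ⦃V : SchemeOver ℂ⦄, IsSmoothProjective d V → ∀ (p : ℕ)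
      ⦃c : complexBetti (V ⊗ V) (2 * p)⦄, c ∈ algebraicClasses (V ⊗ V) p →
        complexBetti.map (CartesianMonoidalCategory.lift (𝟙 V) (𝟙 V)) (2 * p) c ∈ algebraicClasses V p) :
    MotivatedLeAlgebraicHT :=
  fun _ _ hX p ↦ motivatedClasses_le_algebraicClasses_of_standardConjectureB_of_map_diagonal hΔ hB hX p

/-- "Hodge ⇒ motivated" in the middle degree of the even self-powers (NOT a stub: the natural
STRONGER form of stub 1, = the sibling crux `MotivatedLefschetzSplit.HodgeClassesMotivated` applied to
`X^{2N}` in codimension `Nn`, plus the Lefschetz range `Nn ≤ 1`): every rational class of Hodge type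
`(Nn, Nn)` in `H^{2Nn}(X^{2N}(ℂ); ℂ)` is motivated. [cite: Andre1996Motifs, Thm 0.4 and §4] -/
def HodgeMotivatedOnPowers : Prop :=
  ∀ ⦃n : ℕ⦄ ⦃X : Literature.AlgebraicGeometry.Motives.SchemeOver ℂ⦄,
    Literature.AlgebraicGeometry.Motives.IsSmoothProjective n X →
      (let pow := (fun k : ℕ => @Nat.rec (fun _ => Literature.AlgebraicGeometry.Motives.SchemeOver ℂ)
        (CategoryTheory.MonoidalCategoryStruct.tensorUnit (Literature.AlgebraicGeometry.Motives.SchemeOver ℂ))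
        (fun _ Y => CategoryTheory.MonoidalCategoryStruct.tensorObj Y X) k);
      ∀ (N : ℕ) (_hN : Literature.AlgebraicGeometry.Motives.IsSmoothProjective (2 * N * n) (pow (2 * N)))
        (c : Literature.AlgebraicGeometry.HodgeTheory.complexBetti (pow (2 * N)) (2 * (N * n))),
        Literature.AlgebraicGeometry.HodgeTheory.IsRationalClass c →
          Literature.AlgebraicGeometry.HodgeTheory.IsOfHodgeType (2 * N * n) (pow (2 * N))
            (2 * (N * n)) (N * n) (N * n) c →
            c ∈ Literature.AlgebraicGeometry.HodgeTheory.motivatedClasses (2 * N * n) (pow (2 * N)) (N * n))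

/-- The self-powers `X^k := Nat.rec 𝟙 (· ⊗ X) k` of a smooth projective `X` of dimension `n` are
smooth projective of dimension `kn` (the point is, `isSmoothProjective_unit_holds`; products are,
`IsSmoothProjective.tensor_holds`, Segre). [cite: Hartshorne1977, II Ex. 4.9 and III Prop. 10.1 (d)] -/
theorem isSmoothProjective_pow {n : ℕ} {X : SchemeOver ℂ} (hX : IsSmoothProjective n X) :
    ∀ k : ℕ, IsSmoothProjective (k * n)
      (@Nat.rec (fun _ => SchemeOver ℂ) (𝟙_ (SchemeOver ℂ)) (fun _ Y => Y ⊗ X) k)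
  | 0 => by
    rw [Nat.zero_mul]
    exact isSmoothProjective_unit_holds ℂ
  | k + 1 => by
    rw [Nat.succ_mul]
    exact IsSmoothProjective.tensor_holds (isSmoothProjective_pow hX k) hX

/-- **Stub 1 from "Hodge ⇒ motivated on the even self-powers"** (with `δ = 1/2` and ALL `N`): if every
rational `(Nn,Nn)`-class on `X^{2N}` is motivated then their span lies in `A_mot`, so
`dim span ≤ dim A_mot` in the finite-dimensional `H^{2Nn}(X^{2N}(ℂ); ℂ)`. [cite: Andre1996Motifs, Thm 0.4] -/
theorem motivatedDensityHT_of_hodgeMotivatedOnPowers (h : HodgeMotivatedOnPowers) :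
    MotivatedDensityHT := by
  intro n X hX
  refine ⟨1 / 2, by norm_num, Filter.Eventually.frequently (Filter.Eventually.of_forall fun N => ?_)⟩
  have hN : IsSmoothProjective (2 * N * n)
      (@Nat.rec (fun _ => SchemeOver ℂ) (𝟙_ (SchemeOver ℂ)) (fun _ Y => Y ⊗ X) (2 * N)) :=
    isSmoothProjective_pow hX (2 * N)
  refine ⟨hN, ?_⟩
  have hle : Submodule.span ℂ
      {c : complexBetti (@Nat.rec (fun _ => SchemeOver ℂ) (𝟙_ (SchemeOver ℂ)) (fun _ Y => Y ⊗ X) (2 * N))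
          (2 * (N * n)) |
        IsRationalClass c ∧ IsOfHodgeType (2 * N * n)
          (@Nat.rec (fun _ => SchemeOver ℂ) (𝟙_ (SchemeOver ℂ)) (fun _ Y => Y ⊗ X) (2 * N))
          (2 * (N * n)) (N * n) (N * n) c} ≤
      motivatedClasses (2 * N * n)
        (@Nat.rec (fun _ => SchemeOver ℂ) (𝟙_ (SchemeOver ℂ)) (fun _ Y => Y ⊗ X) (2 * N)) (N * n) :=
    Submodule.span_le.2 fun c hc ↦ h hX N hN c hc.1 hc.2
  haveI := finite_complexBetti' hN (2 * (N * n))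
  have hmono := Submodule.finrank_mono hle
  have : (1 / 2 + 1 / 2 : ℝ) = 1 := by norm_num
  rw [this, one_mul]
  exact_mod_cast hmono

end Summit.HodgeConjecture.HodgeConjecture.Cruxes.AlgebraicDensity.RealCarrierSeam

end
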